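import Literature.Combinatorics.SimpleGraph.OrderedRefinementStable
import HarnessLib

/-!
# Ordered colour refinement is label-invariant along any isomorphism

Companion to `OrderedRefinementStable.lean`. For an equivalence `e : W ≃ V` carrying a graph `H` on `W` onto a graph
`G` on `V` (`H.Adj a b ↔ G.Adj (e a) (e b)`) and a colouring `col` of `V`, every round of ordered colour refinement
commutes with `e`: `ocrIter H (col ∘ e) t = ocrIter G col t ∘ e` (`ocrIter_equiv`), through `nbrCount_equiv`,
`profLT_equiv`, `keyLT_equiv`, `ocrStep_equiv`. This is the isomorphism-invariance of the refinement function
("(R3)" of McKay–Piperno) in the generality of two vertex types, as needed when refinement is run on induced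
subgraphs `G.induce ↑W` (whose vertex types are subtypes); the `Fin k`/`Equiv.Perm` special case is
`Literature.Computability.Complexity.ColourRefinementScheme.ocrStep_comap`.

## References

* B. D. McKay, A. Piperno, *Practical graph isomorphism II*, J. Symb. Comput. 60 (2014) 94–112, §3.1 (property (R3):
  the refinement function is label-invariant). [MckayPiperno2014]
* S. Kiefer, B. D. McKay, *The iteration number of colour refinement*, ICALP 2020, Def. 3. [KieferMcKay2020]
-/

namespace Literature.Combinatorics.SimpleGraph

open _root_.SimpleGraph Finset

universe u v

variable {V : Type u} {W : Type v} [Fintype V] [Fintype W] {G : _root_.SimpleGraph V} [DecidableRel G.Adj]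
  {H : _root_.SimpleGraph W} [DecidableRel H.Adj]

/-- Neighbour counts along an isomorphism: `nbrCount H (col ∘ e) u c = nbrCount G col (e u) c`. [folklore] -/
theorem nbrCount_equiv (e : W ≃ V) (hadj : ∀ a b, H.Adj a b ↔ G.Adj (e a) (e b)) (col : V → ℕ) (u : W) (c : ℕ) :
    nbrCount H (col ∘ e) u c = nbrCount G col (e u) c := by
  unfold nbrCount
  exact Finset.card_equiv e fun w => by simp [hadj]

/-- The profile comparison along an isomorphism. [folklore] -/
theorem profLT_equiv (e : W ≃ V) (hadj : ∀ a b, H.Adj a b ↔ G.Adj (e a) (e b)) (col : V → ℕ) (u w : W) :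
    ProfLT H (col ∘ e) u w ↔ ProfLT G col (e u) (e w) := by
  unfold ProfLT
  simp only [nbrCount_equiv e hadj, Function.comp_apply]
  constructor
  · rintro ⟨x, h₁, h₂⟩
    exact ⟨e x, h₁, fun x' hx' => by simpa using h₂ (e.symm x') (by simpa using hx')⟩
  · rintro ⟨x, h₁, h₂⟩
    exact ⟨e.symm x, by simpa using h₁, fun x' hx' => h₂ (e x') (by simpa using hx')⟩

/-- The refinement key order along an isomorphism. [folklore] -/
theorem keyLT_equiv (e : W ≃ V) (hadj : ∀ a b, H.Adj a b ↔ G.Adj (e a) (e b)) (col : V → ℕ) (u w : W) :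
    KeyLT H (col ∘ e) u w ↔ KeyLT G col (e u) (e w) := by
  unfold KeyLT
  rw [profLT_equiv e hadj]
  rfl

/-- **One round of ordered colour refinement is label-invariant along any isomorphism**:
`ocrStep H (col ∘ e) = ocrStep G col ∘ e`. [cite: MckayPiperno2014, §3.1 (property (R3) of the refinement function)] -/
theorem ocrStep_equiv (e : W ≃ V) (hadj : ∀ a b, H.Adj a b ↔ G.Adj (e a) (e b)) (col : V → ℕ) :
    ocrStep H (col ∘ e) = ocrStep G col ∘ e := by
  funext u
  unfold ocrStep
  exact Finset.card_equiv e fun w => by simp [keyLT_equiv e hadj]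

/-- **Every round of ordered colour refinement is label-invariant along any isomorphism**:
`ocrIter H (col ∘ e) t = ocrIter G col t ∘ e`. [cite: MckayPiperno2014, §3.1 (property (R3) of the refinement function)]
[cite: KieferMcKay2020, Def. 3] -/
theorem ocrIter_equiv (e : W ≃ V) (hadj : ∀ a b, H.Adj a b ↔ G.Adj (e a) (e b)) (col : V → ℕ) :
    ∀ t : ℕ, ocrIter H (col ∘ e) t = ocrIter G col t ∘ e
  | 0 => rfl
  | t + 1 => by rw [ocrIter_succ, ocrIter_succ, ocrIter_equiv e hadj col t, ocrStep_equiv e hadj]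

end Literature.Combinatorics.SimpleGraph
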